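import Summits.Langlands.Langlands.Statement
import Literature.NumberTheory.Automorphic.LocalLanglandsDatumGLOne
import Summits.Langlands.Langlands.Theorems.DyadicOddResidueSectorComplementStubEpsArtinEq

/-!
# `𝓡`-independence of the summit `Langlands` (solo-informed, structural reduction 1)

The summit `Langlands` demands the global correspondence for ALL reciprocity data `𝓡`
(Henniart-normalised local Langlands data at every finite place, Artin maps pinned). The only
field of `𝓡` that the clauses `Corresponds` / `IsGeometricFramed` read is
`(𝓡.llc v).recGL n` on the classes `[π_v]` of LOCAL COMPONENTS of cuspidal `π`
(`ReciprocityData.pst` ignores `𝓡` by definition). Hence: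

* `RecAgreeOnCuspidalComponents K` — any two reciprocity data agree on every class that is a
  local component of an L-algebraic cuspidal `π` of some `GL_n(𝔸_K)` — makes
  `GlobalLanglandsCorrespondenceGLn n K 𝓡 hcpt` independent of `𝓡`
  (`globalLanglandsCorrespondenceGLn_iff`), and under it the summit is equivalent to its
  `∃ 𝓡` form (`langlands_iff_exists`). This isolates the purely LOCAL uniqueness statement that
  every proof of the summit as typed must contain (the tree's named fact `localLanglands_gl`
  pins `rec` only on supercuspidal classes; local components are generic, not supercuspidal in
  general).
* Unconditionally for `n = 1`: two reciprocity data have the same `rec₁` at every place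
  (`recGL_one_eq`, from the Artin pin and `recGL_one_eq_recGLOne`), so the `GL₁` case of the
  summit is `𝓡`-independent (`globalLanglandsCorrespondenceGLn_one_iff`).
-/

open scoped MatrixGroups Matrix Classical NumberField
open NumberField IsDedekindDomain Filter
open Literature.NumberTheory.Automorphic Literature.NumberTheory.GaloisRepresentations

set_option linter.dupNamespace false

noncomputable section

namespace Summit.Langlands.Langlands.Theorems

open Summit.Langlands

variable {n : ℕ} {K : Type} [Field K] [NumberField K] {hcpt : isCompact_glFiniteIntegralLevel n K}
  {ℓ : ℕ} [Fact ℓ.Prime]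

/-- **(U_occ)** Any two reciprocity data for `K` agree on every class `[π_v]` that is the local
component at `v` of an L-algebraic cuspidal automorphic representation `π` of some `GL_n(𝔸_K)`.
This is the local uniqueness statement the `∀ 𝓡` of the summit makes load-bearing. [folklore] -/
def RecAgreeOnCuspidalComponents (K : Type) [Field K] [NumberField K] : Prop :=
  ∀ (𝓡 𝓡' : ReciprocityData K) (n : ℕ) (hcpt : isCompact_glFiniteIntegralLevel n K)
    (π : CuspidalAutomorphicRepData n K hcpt), π.1.IsLAlgebraic →
    ∀ (v : HeightOneSpectrum (𝓞 K)) (πv : SmoothIrrep (GL (Fin n) (v.adicCompletion K))),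
      π.1.HasLocalComponentAt v πv.ρ →
      (𝓡.llc v).recGL n (IrrClass.mk πv) = (𝓡'.llc v).recGL n (IrrClass.mk πv)

/-- The pinned `p`-adic Hodge datum does not depend on `𝓡` (by definition). [folklore] -/
theorem pst_eq (𝓡 𝓡' : ReciprocityData K) (v : HeightOneSpectrum (𝓞 K))
    (hv : ((ℓ : ℕ) : 𝓞 K) ∈ v.asIdeal) : 𝓡.pst ℓ v hv = 𝓡'.pst ℓ v hv := rfl

/-- `IsGeometricFramed` does not depend on `𝓡`. [folklore] -/
theorem isGeometricFramed_iff (𝓡 𝓡' : ReciprocityData K) (ρ : FramedGaloisRep K (PadicAlgCl ℓ) n) :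
    IsGeometricFramed 𝓡 ρ ↔ IsGeometricFramed 𝓡' ρ := Iff.rfl

/-- Local–global compatibility at `v` depends on `𝓡` only through `rec_v` on the local
components of `π` at `v`. [folklore] -/
theorem localGlobalCompatibleAt_iff {𝓡 𝓡' : ReciprocityData K} {ι : PadicAlgCl ℓ ≃+* ℂ}
    {π : AutomorphicRepData (AutomorphyDatum.gl n K hcpt)} {ρ : FramedGaloisRep K (PadicAlgCl ℓ) n}
    {v : HeightOneSpectrum (𝓞 K)}
    (hπ : ∀ πv : SmoothIrrep (GL (Fin n) (v.adicCompletion K)), π.HasLocalComponentAt v πv.ρ →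
      (𝓡.llc v).recGL n (IrrClass.mk πv) = (𝓡'.llc v).recGL n (IrrClass.mk πv)) :
    LocalGlobalCompatibleAt 𝓡 ι π ρ v ↔ LocalGlobalCompatibleAt 𝓡' ι π ρ v := by
  constructor
  · rintro ⟨πv, r, rℂ, hloc, h₁, h₂, h₃, h₄⟩
    exact ⟨πv, r, rℂ, hloc, h₁, h₂, h₃, hπ πv hloc ▸ h₄⟩
  · rintro ⟨πv, r, rℂ, hloc, h₁, h₂, h₃, h₄⟩
    exact ⟨πv, r, rℂ, hloc, h₁, h₂, h₃, (hπ πv hloc).symm ▸ h₄⟩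

/-- `Corresponds` depends on `𝓡` only through `rec_v` on the local components of `π`. [folklore] -/
theorem corresponds_iff {𝓡 𝓡' : ReciprocityData K} {ι : PadicAlgCl ℓ ≃+* ℂ}
    {π : AutomorphicRepData (AutomorphyDatum.gl n K hcpt)} {ρ : FramedGaloisRep K (PadicAlgCl ℓ) n}
    (hπ : ∀ (v : HeightOneSpectrum (𝓞 K)) (πv : SmoothIrrep (GL (Fin n) (v.adicCompletion K))),
      π.HasLocalComponentAt v πv.ρ →
      (𝓡.llc v).recGL n (IrrClass.mk πv) = (𝓡'.llc v).recGL n (IrrClass.mk πv)) :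
    Corresponds 𝓡 ι π ρ ↔ Corresponds 𝓡' ι π ρ :=
  and_congr Iff.rfl (forall_congr' fun v ↦ localGlobalCompatibleAt_iff (hπ v))

/-- Direction (A) is `𝓡`-independent given agreement on local components of L-algebraic
cuspidal `π`. [folklore] -/
theorem automorphicToGalois_iff {𝓡 𝓡' : ReciprocityData K} (hcpt : isCompact_glFiniteIntegralLevel n K)
    (h : ∀ π : CuspidalAutomorphicRepData n K hcpt, π.1.IsLAlgebraic →
      ∀ (v : HeightOneSpectrum (𝓞 K)) (πv : SmoothIrrep (GL (Fin n) (v.adicCompletion K))),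
        π.1.HasLocalComponentAt v πv.ρ →
        (𝓡.llc v).recGL n (IrrClass.mk πv) = (𝓡'.llc v).recGL n (IrrClass.mk πv)) :
    AutomorphicToGalois n 𝓡 hcpt ↔ AutomorphicToGalois n 𝓡' hcpt := by
  refine forall_congr' fun π ↦ forall_congr' fun hπ ↦ forall_congr' fun ℓ ↦
    forall_congr' fun _ ↦ forall_congr' fun ι ↦ exists_congr fun ρ ↦ ?_
  rw [isGeometricFramed_iff 𝓡 𝓡', corresponds_iff (h π hπ)]
  refine and_congr Iff.rfl (and_congr Iff.rfl (and_congr Iff.rfl (forall_congr' fun ρ' ↦ ?_)))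
  rw [corresponds_iff (h π hπ)]

/-- Direction (B) is `𝓡`-independent given agreement on local components of L-algebraic
cuspidal `π`. [folklore] -/
theorem galoisToAutomorphic_iff {𝓡 𝓡' : ReciprocityData K} (hcpt : isCompact_glFiniteIntegralLevel n K)
    (h : ∀ π : CuspidalAutomorphicRepData n K hcpt, π.1.IsLAlgebraic →
      ∀ (v : HeightOneSpectrum (𝓞 K)) (πv : SmoothIrrep (GL (Fin n) (v.adicCompletion K))),
        π.1.HasLocalComponentAt v πv.ρ →
        (𝓡.llc v).recGL n (IrrClass.mk πv) = (𝓡'.llc v).recGL n (IrrClass.mk πv)) :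
    GaloisToAutomorphic n 𝓡 hcpt ↔ GaloisToAutomorphic n 𝓡' hcpt := by
  refine forall_congr' fun ℓ ↦ forall_congr' fun _ ↦ forall_congr' fun ι ↦
    forall_congr' fun ρ ↦ forall_congr' fun _ ↦ ?_
  rw [isGeometricFramed_iff 𝓡 𝓡']
  refine forall_congr' fun _ ↦ exists_congr fun π ↦ ?_
  constructor
  · rintro ⟨hπ, hc⟩
    exact ⟨hπ, (corresponds_iff (h π hπ)).1 hc⟩
  · rintro ⟨hπ, hc⟩
    exact ⟨hπ, (corresponds_iff (h π hπ)).2 hc⟩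

/-- **The correspondence for `GL_n/K` is `𝓡`-independent** given agreement of the two data on
the local components of L-algebraic cuspidal `π` of `GL_n(𝔸_K)`. [folklore] -/
theorem globalLanglandsCorrespondenceGLn_iff {𝓡 𝓡' : ReciprocityData K}
    (hcpt : isCompact_glFiniteIntegralLevel n K)
    (h : ∀ π : CuspidalAutomorphicRepData n K hcpt, π.1.IsLAlgebraic →
      ∀ (v : HeightOneSpectrum (𝓞 K)) (πv : SmoothIrrep (GL (Fin n) (v.adicCompletion K))),
        π.1.HasLocalComponentAt v πv.ρ →
        (𝓡.llc v).recGL n (IrrClass.mk πv) = (𝓡'.llc v).recGL n (IrrClass.mk πv)) :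
    GlobalLanglandsCorrespondenceGLn n K 𝓡 hcpt ↔ GlobalLanglandsCorrespondenceGLn n K 𝓡' hcpt :=
  and_congr (automorphicToGalois_iff hcpt h) (galoisToAutomorphic_iff hcpt h)

/-- **Summit, `∃ 𝓡` form.** Under (U_occ) at every number field, `Langlands` is equivalent to:
for every number field there is SOME reciprocity datum for which the global correspondence
holds for all `n ≥ 1`. [folklore] -/
theorem langlands_iff_exists
    (hU : ∀ (K : Type) [Field K] [NumberField K], RecAgreeOnCuspidalComponents K) :
    _root_.Langlands ↔
      ∀ (F : Type) [Field F] [NumberField F], ∃ 𝓡 : ReciprocityData F, ∀ n : ℕ, 0 < n →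
        ∀ hcpt : isCompact_glFiniteIntegralLevel n F, GlobalLanglandsCorrespondenceGLn n F 𝓡 hcpt := by
  constructor
  · intro hL F _ _
    obtain ⟨⟨𝓡⟩, h⟩ := hL F
    exact ⟨𝓡, h 𝓡⟩
  · intro h F _ _
    obtain ⟨𝓡, h𝓡⟩ := h F
    refine ⟨⟨𝓡⟩, fun 𝓡' n hn hcpt ↦ ?_⟩
    exact (globalLanglandsCorrespondenceGLn_iff hcpt
      (fun π hπ v πv hloc ↦ hU F 𝓡 𝓡' n hcpt π hπ v πv hloc)).1 (h𝓡 n hn hcpt)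

/-! ## The case `n = 1`: unconditional `𝓡`-independence -/

/-- Two reciprocity data have the SAME local Artin datum at every place (the pin). [folklore] -/
theorem llc_artin_eq (𝓡 𝓡' : ReciprocityData K) (v : HeightOneSpectrum (𝓞 K)) :
    (𝓡.llc v).artin = (𝓡'.llc v).artin :=
  ReciprocityRigidity.localArtinData_eq_of_artin_eq (𝓡.artin_eq 𝓡' v)

/-- **Two reciprocity data have the same `rec₁` at every place**: `rec₁` is local class field
theory against the pinned Artin map (`recGL_one_eq_recGLOne`). [folklore] -/
theorem recGL_one_eq (𝓡 𝓡' : ReciprocityData K) (v : HeightOneSpectrum (𝓞 K)) :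
    (𝓡.llc v).recGL 1 = (𝓡'.llc v).recGL 1 := by
  rw [(𝓡.llc v).recGL_one_eq_recGLOne, (𝓡'.llc v).recGL_one_eq_recGLOne, llc_artin_eq 𝓡 𝓡' v]

/-- **The `GL₁` case of the summit is `𝓡`-independent**, unconditionally. [folklore] -/
theorem globalLanglandsCorrespondenceGLn_one_iff (𝓡 𝓡' : ReciprocityData K)
    (hcpt : isCompact_glFiniteIntegralLevel 1 K) :
    GlobalLanglandsCorrespondenceGLn 1 K 𝓡 hcpt ↔ GlobalLanglandsCorrespondenceGLn 1 K 𝓡' hcpt :=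
  globalLanglandsCorrespondenceGLn_iff hcpt fun _ _ v πv _ ↦ by rw [recGL_one_eq 𝓡 𝓡' v]

end Summit.Langlands.Langlands.Theorems

end
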